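import Mathlib
import Literature.MathematicalPhysics.QuantumFieldTheory.Balaban1983to89.B5Ineq167SharpUpperZd

/-!
# [B5] (1.67) p.29 — the scalar inequality (1.67) on `ℤ^d` for EVERY square-summable coarse field:
# the whole-lattice action form `⟨B, Δ^{scalar}_{n,a}B⟩_{ℤ^d}` on `ℓ²(ℤ^d)` and
# `⟨∂₁B, ∂₁B⟩ ≤ ⟨B, Δ^{scalar}_{n,a}B⟩_{ℤ^d} ≤ (π²/4)^{d+1}·⟨∂₁B, ∂₁B⟩` without a finite-support hypothesis

[B5] = T. Bałaban, *Propagators and renormalization transformations for lattice gauge theories. I*, Commun.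
Math. Phys. **95** (1984) 17–40 [`Balaban1984PropagatorsI`].  PRINTED TEXT, p. 29 [PDF 13] (TEXT LOCATIONS ONLY —
nothing printed enters as a hypothesis; quotations checked against the page render read as an image):
«The action Δ_k is thus defined by ⟨B, Δ_kB⟩ = ⟨∂H_kB, ∂H_kB⟩. (1.65)» and, after the momentum representation
(1.66), «The function under the integral is bounded from below and above by positive constants γ₀, γ₁ dependent
on d only, so we have γ₀⟨∂₁B, ∂₁B⟩ ≦ ⟨B, Δ_kB⟩ ≦ γ₁⟨∂₁B, ∂₁B⟩. (1.67)».  The printed (1.67) carries NO restriction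
on the coarse field `B` (in the print `B` is any configuration on the bonds of the unit torus `T₁^{(k)}`: the symbol
and the domain are fixed on p. 20 [PDF 4], (1.18) «(Q_kA)_b = Σ_{x∈B^k(b_−)} η^{d+1}A([x, x(b)]), b ⊂ T₁^{(k)} =
ℤ^d ∩ T_η, η = L^{−k},» and (1.19) «((ST)^k e^{−S})(B) = Z_{k,Ax} exp(−½⟨B, Δ_kB⟩).» — render p004 read as an image;
v1 mislocated this gloss at p. 18 [PDF 2], DOCFIX D-1 of XREAD C-pv01-102).

WHAT THIS LEAF ADDS (the quantifier).  The pv23 column proves the scalar whole-lattice shadow of (1.67) with the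
explicit constants `γ₀ = 1` (node 9, `B5Ineq167LowerZd.ineq167_lower_scalar`) and `γ₁♯(d) = (π²/4)^{d+1}`
(node g9-4, `B5Ineq167SharpUpperZd.ineq167_scalar_sharp`) for coarse fields `B : ℤ^d → ℝ` SUPPORTED IN A FINITE
SET `T` — the form being the finite double sum `B5Hk165ActionZd.actionForm n a T B =
Σ_{y″,y ∈ T} B(y″)B(y)Δ^{scalar}_{n,a}(y″,y)`.  On the infinite lattice the natural domain of the form is
`ℓ²(ℤ^d)`: the kernel is a convolution kernel `Δ^{scalar}(y″,y) = κ(y″ − y)` with `κ ∈ ℓ¹(ℤ^d)` (node g8-2,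
`B5Ineq167SymbolZd.actionKer_eq_kappa`, `summable_abs_kappa`).  Here:

* §1–§2 **`actionFormZd n a B = Σ_{(x,y) ∈ ℤ^d × ℤ^d} B(x)B(y)Δ^{scalar}_{n,a}(x,y)`**, an unconditional sum over
  `ℤ^d × ℤ^d`, **absolutely convergent for every square-summable `B`** with the Young/AM–GM bound
  `Σ_{x,y} |B(x)||B(y)||Δ^{scalar}(x,y)| ≤ ‖κ‖_{ℓ¹}·‖B‖²_{ℓ²}` (`tsum_abs_pairTerm_le`, `abs_actionFormZd_le`:
  the form is bounded on `ℓ²(ℤ^d)`), its iterated and convolution (autocorrelation) expressions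
  `Σ_x Σ_y …` and `Σ_z κ(z)·Σ_x B(x)B(x − z)` (`actionFormZd_eq_tsum_tsum`, `actionFormZd_eq_kappa`);
* §3 **agreement with the column's finite-volume form**: `actionFormZd n a (B·1_T) = actionForm n a T B` and
  `actionFormZd n a B = actionForm n a T B` whenever `B` vanishes off `T` (`actionFormZd_cutoff`,
  `actionFormZd_eq_actionForm`) — so (1.65) of node 8 (`B5Hk165ActionZd.energy_HB_eq`) reads
  `⟨∂HB, ∂HB⟩ = (n+1)^{d−2}·actionFormZd` on finitely supported fields (`energy_HB_eq_actionFormZd`);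
* §4 **exhaustion**: along the directed set of finite `T ⊂ ℤ^d`, `actionForm n a T B → actionFormZd n a B` and
  `⟨∂₁(B·1_T), ∂₁(B·1_T)⟩ → ⟨∂₁B, ∂₁B⟩` for square-summable `B` (Tannery / dominated convergence,
  `tendsto_actionForm`, `tendsto_energy_cutoff`);
* §5 **`ineq167_scalar_l2`: for every `n`, every `a > 0` and EVERY `B ∈ ℓ²(ℤ^d)`,
  `⟨∂₁B, ∂₁B⟩ ≤ ⟨B, Δ^{scalar}_{n,a}B⟩_{ℤ^d} ≤ (π²/4)^{d+1}·⟨∂₁B, ∂₁B⟩`** (node g9-4's inequality on the cut-off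
  fields `B·1_T`, passed to the limit), the two halves `ineq167_lower_l2` / `ineq167_upper_l2`, positivity
  `actionFormZd_nonneg`, and the printed shape `ineq167_l2_exists : ∃ γ₀, γ₁ > 0` depending on `d` only;
* §6 the operator reading: the rows `(Δ^{scalar}_{n,a}B)(x) = Σ_y Δ^{scalar}(x,y)B(y)` converge absolutely on
  `ℓ²(ℤ^d)` (`summable_deltaApply_row`) and `⟨B, Δ^{scalar}B⟩_{ℤ^d} = Σ_x B(x)(Δ^{scalar}B)(x)`
  (`actionFormZd_eq_inner`).

DICTIONARY (as the column).  Unit coarse lattice `ℤ^d = B6QGQLower276.X d`, blocks of side `n + 1` (`n + 1 = L^k`),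
dummy mass `a > 0`; `Δ^{scalar}_{n,a}(y″,y) = B5Hk165ActionZd.actionKer n a y″ y = (Q′G′Q′*)⁻¹(y″,y) − a·δ_{y″y}`;
`⟨∂₁B, ∂₁B⟩ = B5Hk103Minimizer.energy B = Σ_μ Σ_p (B(p) − B(p + e_μ))²` (a `tsum`; the true Dirichlet energy on
`ℓ²`); `‖B‖²_{ℓ²} = Σ_x B(x)²`, membership in `ℓ²(ℤ^d)` is `Summable fun x => B x ^ 2` as everywhere in the column.

HONEST SCOPE.  (i) Scalar shadow `U = 1`, unit lattice, `m² = 0`, dummy mass `a > 0`, INFINITE lattice `ℤ^d` — NOT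
the covariant statement of [B5] and NOT the torus `T₁^{(k)}` of the print (the torus / vector operator version of
(1.67) is the β cell's `Beta.Ineq167OperatorUpper`, untouched here).  (ii) On `ℤ^d` the statement for ALL of
`ℓ²(ℤ^d)` is the faithful reading of the unrestricted quantifier of (1.67) for the bounded form; fields of finite
energy but infinite `ℓ²` norm (e.g. non-zero constants in any `d`, or profiles decaying like `|x|^{−s}`,
`(d−2)/2 < s ≤ d/2`) are NOT treated — the `ℓ²` bounds fix the form's unique bounded extension to the energy closure
of `ℓ²` with the same constants, only its identification with a concrete lattice sum is left open (O-1 / I-2 of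
XREAD C-pv01-102).  (iii) The constants are the column's
(`γ₀ = 1`, node 9; `γ₁♯ = (π²/4)^{d+1}`, node g9-4), not claimed optimal.  (iv) Everything here is [folklore]
functional analysis (absolute convergence, Fubini on `ℤ^d × ℤ^d`, dominated convergence) around ONE printed
inequality; nothing printed is a hypothesis, every statement is a closed theorem over the tree's definitions.
Value = kernel discharge of the quantifier of one printed inequality in the scalar infinite-volume shadow; NOT
summit progress, nothing about the continuum limit or the Clay problem.

ABSOLUTE-RULE CENSUS: hypotheses of the theorems below are `0 < a` and `Summable fun x => B x ^ 2` only; no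
`Prop`-valued printed statement, no internally minted fact.  Citations: [Balaban1984PropagatorsI] (1.65)/(1.67)
p. 29 — text locations; everything else [folklore].  Unit `b2b-balaban-pv23-g10` (SURGE NODE PROVER #23 gen 10,
scalar whole-lattice `ℤ^d` column, self-row B5-167-L2-ZD); staged byte-identically under `HOME/lean/BalabanYm4/`.
REVISION v1.0.1 (docstring-only; declarations, statements and proofs byte-identical to v1 p191340): header locator of
the `T₁^{(k)}` gloss corrected to p. 20 [PDF 4] (1.18)–(1.19) and HONEST SCOPE (ii) example sharpened, per XREAD
C-pv01-102 (b2b-balaban-pv01-g18) D-1 / O-1.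
-/

namespace Literature.MathematicalPhysics.QuantumFieldTheory.Balaban1983to89.B5Ineq167L2Zd

open Filter Topology
open B6QGQLower276 (X e)
open B5Hk103Minimizer (energy HB)
open B5Hk103Unique (summable_mul_of_sq summable_sq_shift tsum_addRight)
open B5Hk165ActionZd (actionForm actionKer energy_HB_eq)
open B5Ineq167SymbolZd (kappa actionKer_eq_kappa summable_abs_kappa)
open B5Ineq167SharpUpperZd (gamma1Sharp gamma1Sharp_pos ineq167_scalar_sharp)
open scoped Real

noncomputable section

variable {d : ℕ}

/-! ## §1  The objects: cut-off fields, the pair summand, the whole-lattice form [folklore dictionary] -/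

/-- The cut-off `B·1_T` of a coarse field to a finite set of sites `T`. [folklore] -/
def cutoff (T : Finset (X d)) (B : X d → ℝ) (y : X d) : ℝ := if y ∈ T then B y else 0

/-- The pair summand `B(x)·B(y)·Δ^{scalar}_{n,a}(x,y)` of the action form, indexed by `(x,y) ∈ ℤ^d × ℤ^d`.
[folklore] -/
def pairTerm (n : ℕ) (a : ℝ) (B : X d → ℝ) (xy : X d × X d) : ℝ := B xy.1 * B xy.2 * actionKer n a xy.1 xy.2

/-- **The whole-lattice coarse action form** `⟨B, Δ^{scalar}_{n,a}B⟩_{ℤ^d} = Σ_{(x,y) ∈ ℤ^d × ℤ^d} B(x)B(y)Δ^{scalar}(x,y)`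
as an unconditional sum over `ℤ^d × ℤ^d` (absolutely convergent on `ℓ²(ℤ^d)`, §2; equal to the column's finite
double sum on finitely supported fields, §3). [cite: Balaban1984PropagatorsI, (1.65) p.29] -/
def actionFormZd (n : ℕ) (a : ℝ) (B : X d → ℝ) : ℝ := ∑' xy : X d × X d, pairTerm n a B xy

/-- On `T` the cut-off field is the field. [folklore] -/
theorem cutoff_of_mem {T : Finset (X d)} {B : X d → ℝ} {y : X d} (h : y ∈ T) : cutoff T B y = B y := if_pos h

/-- Off `T` the cut-off field vanishes. [folklore] -/
theorem cutoff_of_not_mem {T : Finset (X d)} {B : X d → ℝ} {y : X d} (h : y ∉ T) : cutoff T B y = 0 := if_neg h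

/-- A field vanishing off `T` equals its cut-off. [folklore] -/
theorem cutoff_eq_self {T : Finset (X d)} {B : X d → ℝ} (hT : ∀ y ∉ T, B y = 0) : cutoff T B = B := by
  funext y
  by_cases h : y ∈ T
  · exact cutoff_of_mem h
  · rw [cutoff_of_not_mem h, hT y h]

/-- `(B·1_T)(y)² ≤ B(y)²`. [folklore] -/
theorem sq_cutoff_le (T : Finset (X d)) (B : X d → ℝ) (y : X d) : cutoff T B y ^ 2 ≤ B y ^ 2 := by
  by_cases h : y ∈ T
  · rw [cutoff_of_mem h]
  · rw [cutoff_of_not_mem h, zero_pow two_ne_zero]; exact sq_nonneg _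

/-! ## §2  Absolute convergence on `ℓ²(ℤ^d)`: `Σ_{x,y}|B(x)||B(y)||κ(x − y)| ≤ ‖κ‖₁‖B‖₂²` [folklore] -/

/-- AM–GM for the shifted autocorrelation: `Σ_x |B(x)||B(x − z)|` converges and is `≤ Σ_x B(x)²`. [folklore] -/
theorem tsum_abs_mul_abs_sub_le {B : X d → ℝ} (hB : Summable fun x => B x ^ 2) (z : X d) :
    (Summable fun x => |B x| * |B (x - z)|) ∧ ∑' x, |B x| * |B (x - z)| ≤ ∑' x, B x ^ 2 := by
  have hBz : Summable fun x => B (x - z) ^ 2 := by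
    simpa only [sub_eq_add_neg] using summable_sq_shift hB (-z)
  have h1 : Summable fun x => |B x| ^ 2 := by simpa only [sq_abs] using hB
  have h2 : Summable fun x => |B (x - z)| ^ 2 := by simpa only [sq_abs] using hBz
  have hs : Summable fun x => |B x| * |B (x - z)| := summable_mul_of_sq h1 h2
  refine ⟨hs, ?_⟩
  have hle : ∀ x, |B x| * |B (x - z)| ≤ (B x ^ 2 + B (x - z) ^ 2) / 2 := fun x => by
    nlinarith [sq_nonneg (|B x| - |B (x - z)|), sq_abs (B x), sq_abs (B (x - z))]
  have hshift : ∑' x, B (x - z) ^ 2 = ∑' x, B x ^ 2 := by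
    simpa only [sub_eq_add_neg] using tsum_addRight (F := fun x => B x ^ 2) (-z)
  calc ∑' x, |B x| * |B (x - z)| ≤ ∑' x, (B x ^ 2 + B (x - z) ^ 2) / 2 :=
        hs.tsum_le_tsum hle ((hB.add hBz).div_const 2)
    _ = (∑' x, B x ^ 2 + ∑' x, B (x - z) ^ 2) / 2 := by rw [tsum_div_const, hB.tsum_add hBz]
    _ = ∑' x, B x ^ 2 := by rw [hshift]; ring

/-- The shear `(z, x) ↦ (x, x − z)` of `ℤ^d × ℤ^d` (inverse `(x, y) ↦ (x − y, x)`): it turns the pair summand into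
`|κ(z)|·|B(x)||B(x − z)|`. [folklore] -/
def shear : X d × X d ≃ X d × X d where
  toFun zx := (zx.2, zx.2 - zx.1)
  invFun xy := (xy.1 - xy.2, xy.1)
  left_inv zx := by simp
  right_inv xy := by simp

/-- The pair summand through the shear: `pairTerm (x, x − z) = κ(z)·(B(x)B(x − z))`. [folklore] -/
theorem pairTerm_shear (n : ℕ) {a : ℝ} (ha : 0 < a) (B : X d → ℝ) (zx : X d × X d) :
    pairTerm n a B (shear zx) = kappa n a zx.1 * (B zx.2 * B (zx.2 - zx.1)) := by
  show B zx.2 * B (zx.2 - zx.1) * actionKer n a zx.2 (zx.2 - zx.1) = _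
  rw [actionKer_eq_kappa n ha, sub_sub_cancel]
  ring

/-- **Absolute convergence of the whole-lattice form on `ℓ²(ℤ^d)`**: `Σ_{(x,y)} |B(x)B(y)Δ^{scalar}(x,y)| < ∞`.
[folklore] -/
theorem summable_abs_pairTerm (n : ℕ) {a : ℝ} (ha : 0 < a) {B : X d → ℝ} (hB : Summable fun x => B x ^ 2) :
    Summable fun xy : X d × X d => |pairTerm n a B xy| := by
  set g : X d × X d → ℝ := fun zx => |kappa n a zx.1| * (|B zx.2| * |B (zx.2 - zx.1)|) with hg
  have hg0 : 0 ≤ g := fun zx => by simp only [hg]; positivity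
  have hgs : Summable g := by
    refine (summable_prod_of_nonneg hg0).2 ⟨fun z => ?_, ?_⟩
    · simpa only [hg] using (tsum_abs_mul_abs_sub_le hB z).1.mul_left |kappa n a z|
    · have hrow : ∀ z : X d, ∑' x : X d, g (z, x) = |kappa n a z| * ∑' x : X d, |B x| * |B (x - z)| := by
        intro z; simp only [hg]; rw [tsum_mul_left]
      simp_rw [hrow]
      refine Summable.of_nonneg_of_le (fun z => ?_) (fun z => ?_)
        ((summable_abs_kappa n ha).mul_right (∑' x : X d, B x ^ 2))
      · exact mul_nonneg (abs_nonneg _) (tsum_nonneg fun x => by positivity)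
      · exact mul_le_mul_of_nonneg_left (tsum_abs_mul_abs_sub_le hB z).2 (abs_nonneg _)
  have hcomp : (fun xy : X d × X d => |pairTerm n a B xy|) ∘ shear = g := by
    funext zx
    simp only [Function.comp_apply, hg, pairTerm_shear n ha, abs_mul]
  exact (shear (d := d)).summable_iff.1 (hcomp ▸ hgs)

/-- The pair summand is summable over `ℤ^d × ℤ^d` for `B ∈ ℓ²(ℤ^d)`. [folklore] -/
theorem summable_pairTerm (n : ℕ) {a : ℝ} (ha : 0 < a) {B : X d → ℝ} (hB : Summable fun x => B x ^ 2) :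
    Summable (pairTerm n a B) :=
  (summable_abs_pairTerm n ha hB).of_abs

/-- **The Young/AM–GM bound** `Σ_{(x,y)} |B(x)B(y)Δ^{scalar}(x,y)| ≤ ‖κ‖_{ℓ¹}·‖B‖²_{ℓ²}`. [folklore] -/
theorem tsum_abs_pairTerm_le (n : ℕ) {a : ℝ} (ha : 0 < a) {B : X d → ℝ} (hB : Summable fun x => B x ^ 2) :
    ∑' xy : X d × X d, |pairTerm n a B xy| ≤ (∑' z : X d, |kappa n a z|) * ∑' x : X d, B x ^ 2 := by
  have habs := summable_abs_pairTerm n ha hB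
  have hg : Summable fun zx : X d × X d => |pairTerm n a B (shear zx)| := (shear (d := d)).summable_iff.2 habs
  rw [← (shear (d := d)).tsum_eq fun xy => |pairTerm n a B xy|, hg.tsum_prod' fun z => hg.prod_factor z]
  have hrow : ∀ z : X d, ∑' x : X d, |pairTerm n a B (shear (z, x))|
      = |kappa n a z| * ∑' x : X d, |B x| * |B (x - z)| := by
    intro z
    rw [← tsum_mul_left]
    exact tsum_congr fun x => by rw [pairTerm_shear n ha, abs_mul, abs_mul]
  simp_rw [hrow]
  rw [← tsum_mul_right]
  refine Summable.tsum_le_tsum (fun z => ?_) ?_ ((summable_abs_kappa n ha).mul_right _)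
  · exact mul_le_mul_of_nonneg_left (tsum_abs_mul_abs_sub_le hB z).2 (abs_nonneg _)
  · refine Summable.of_nonneg_of_le (fun z => ?_) (fun z => ?_)
      ((summable_abs_kappa n ha).mul_right (∑' x : X d, B x ^ 2))
    · exact mul_nonneg (abs_nonneg _) (tsum_nonneg fun x => by positivity)
    · exact mul_le_mul_of_nonneg_left (tsum_abs_mul_abs_sub_le hB z).2 (abs_nonneg _)

/-- **Boundedness of the form on `ℓ²(ℤ^d)`**: `|⟨B, Δ^{scalar}_{n,a}B⟩_{ℤ^d}| ≤ ‖κ‖_{ℓ¹}·‖B‖²_{ℓ²}`. [folklore] -/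
theorem abs_actionFormZd_le (n : ℕ) {a : ℝ} (ha : 0 < a) {B : X d → ℝ} (hB : Summable fun x => B x ^ 2) :
    |actionFormZd n a B| ≤ (∑' z : X d, |kappa n a z|) * ∑' x : X d, B x ^ 2 := by
  have h := norm_tsum_le_tsum_norm (f := pairTerm n a B)
    (by simpa only [Real.norm_eq_abs] using summable_abs_pairTerm n ha hB)
  simp only [Real.norm_eq_abs] at h
  exact h.trans (tsum_abs_pairTerm_le n ha hB)

/-- The iterated form `Σ_x Σ_y B(x)B(y)Δ^{scalar}(x,y)` of the whole-lattice action (Fubini). [folklore] -/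
theorem actionFormZd_eq_tsum_tsum (n : ℕ) {a : ℝ} (ha : 0 < a) {B : X d → ℝ} (hB : Summable fun x => B x ^ 2) :
    actionFormZd n a B = ∑' x : X d, ∑' y : X d, B x * B y * actionKer n a x y := by
  rw [actionFormZd, (summable_pairTerm n ha hB).tsum_prod' fun x => (summable_pairTerm n ha hB).prod_factor x]
  rfl

/-- **The convolution (autocorrelation) form** `⟨B, Δ^{scalar}B⟩_{ℤ^d} = Σ_z κ(z)·Σ_x B(x)B(x − z)` — the
position-space counterpart of the momentum representation (1.66). [cite: Balaban1984PropagatorsI, (1.66) p.29] -/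
theorem actionFormZd_eq_kappa (n : ℕ) {a : ℝ} (ha : 0 < a) {B : X d → ℝ} (hB : Summable fun x => B x ^ 2) :
    actionFormZd n a B = ∑' z : X d, kappa n a z * ∑' x : X d, B x * B (x - z) := by
  have hg : Summable fun zx : X d × X d => pairTerm n a B (shear zx) :=
    (shear (d := d)).summable_iff.2 (summable_pairTerm n ha hB)
  rw [actionFormZd, ← (shear (d := d)).tsum_eq (pairTerm n a B), hg.tsum_prod' fun z => hg.prod_factor z]
  refine tsum_congr fun z => ?_
  rw [← tsum_mul_left]
  exact tsum_congr fun x => pairTerm_shear n ha B (z, x)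

/-! ## §3  Agreement with the finite-volume form of the column [folklore] -/

/-- The pair summand of a cut-off field is the cut-off pair summand. [folklore] -/
theorem pairTerm_cutoff (n : ℕ) (a : ℝ) (T : Finset (X d)) (B : X d → ℝ) (xy : X d × X d) :
    pairTerm n a (cutoff T B) xy = if xy ∈ T ×ˢ T then pairTerm n a B xy else 0 := by
  unfold pairTerm cutoff
  by_cases hx : xy.1 ∈ T <;> by_cases hy : xy.2 ∈ T <;> simp [hx, hy, Finset.mem_product]

/-- The finite-volume form as a sum over `T × T` of the pair summand. [folklore] -/
theorem actionForm_eq_sum_product (n : ℕ) (a : ℝ) (T : Finset (X d)) (B : X d → ℝ) :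
    actionForm n a T B = ∑ xy ∈ T ×ˢ T, pairTerm n a B xy := by
  rw [actionForm, Finset.sum_product]
  rfl

/-- The finite-volume form over `T` only sees the values on `T`. [folklore] -/
theorem actionForm_cutoff (n : ℕ) (a : ℝ) (T : Finset (X d)) (B : X d → ℝ) :
    actionForm n a T (cutoff T B) = actionForm n a T B := by
  unfold actionForm
  exact Finset.sum_congr rfl fun x hx => Finset.sum_congr rfl fun y hy => by
    rw [cutoff_of_mem hx, cutoff_of_mem hy]

/-- The finite-volume form as a cut-off unconditional sum over `ℤ^d × ℤ^d`. [folklore] -/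
theorem actionForm_eq_tsum_ite (n : ℕ) (a : ℝ) (T : Finset (X d)) (B : X d → ℝ) :
    actionForm n a T B = ∑' xy : X d × X d, if xy ∈ T ×ˢ T then pairTerm n a B xy else 0 := by
  rw [tsum_eq_sum (s := T ×ˢ T) fun xy hxy => if_neg hxy, actionForm_eq_sum_product]
  exact Finset.sum_congr rfl fun xy hxy => (if_pos hxy).symm

/-- **The whole-lattice form of a cut-off field is the column's finite-volume form**:
`actionFormZd n a (B·1_T) = actionForm n a T B`. [folklore] -/
theorem actionFormZd_cutoff (n : ℕ) (a : ℝ) (T : Finset (X d)) (B : X d → ℝ) :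
    actionFormZd n a (cutoff T B) = actionForm n a T B := by
  unfold actionFormZd
  simp_rw [pairTerm_cutoff]
  exact (actionForm_eq_tsum_ite n a T B).symm

/-- **On finitely supported fields the two forms agree**: if `B` vanishes off `T` then
`⟨B, Δ^{scalar}B⟩_{ℤ^d} = actionForm n a T B`. [folklore] -/
theorem actionFormZd_eq_actionForm (n : ℕ) (a : ℝ) (T : Finset (X d)) (B : X d → ℝ) (hT : ∀ y ∉ T, B y = 0) :
    actionFormZd n a B = actionForm n a T B := by
  rw [← actionFormZd_cutoff n a T B, cutoff_eq_self hT]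

/-- (1.65) of node 8 in whole-lattice dress: for `B` vanishing off `T`, the energy of the minimiser `HB` is
`(n+1)^d/(n+1)²·⟨B, Δ^{scalar}_{n,a}B⟩_{ℤ^d}`. [cite: Balaban1984PropagatorsI, (1.65) p.29] -/
theorem energy_HB_eq_actionFormZd (n : ℕ) {a : ℝ} (ha : 0 < a) (T : Finset (X d)) (B : X d → ℝ)
    (hT : ∀ y ∉ T, B y = 0) :
    energy (HB n a T B) = ((n : ℝ) + 1) ^ d / ((n : ℝ) + 1) ^ 2 * actionFormZd n a B := by
  rw [actionFormZd_eq_actionForm n a T B hT, energy_HB_eq n ha T B hT]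

/-! ## §4  Exhaustion of `ℤ^d` by finite sets: continuity of both sides along the cut-offs [folklore] -/

/-- **`actionForm n a T B → ⟨B, Δ^{scalar}B⟩_{ℤ^d}`** along the directed set of finite `T ⊂ ℤ^d`, for
`B ∈ ℓ²(ℤ^d)` (dominated convergence on `ℤ^d × ℤ^d`, majorant `|B(x)B(y)Δ^{scalar}(x,y)|`). [folklore] -/
theorem tendsto_actionForm (n : ℕ) {a : ℝ} (ha : 0 < a) {B : X d → ℝ} (hB : Summable fun x => B x ^ 2) :
    Tendsto (fun T : Finset (X d) => actionForm n a T B) atTop (𝓝 (actionFormZd n a B)) := by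
  simp_rw [actionForm_eq_tsum_ite]
  refine tendsto_tsum_of_dominated_convergence (bound := fun xy => |pairTerm n a B xy|)
    (summable_abs_pairTerm n ha hB) (fun xy => ?_) (Eventually.of_forall fun T xy => ?_)
  · have hev : (fun T : Finset (X d) => if xy ∈ T ×ˢ T then pairTerm n a B xy else 0)
        =ᶠ[atTop] fun _ => pairTerm n a B xy := by
      filter_upwards [eventually_ge_atTop ({xy.1, xy.2} : Finset (X d))] with T hT
      exact if_pos (Finset.mem_product.2 ⟨hT (by simp), hT (by simp)⟩)
    exact tendsto_const_nhds.congr' hev.symm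
  · by_cases h : xy ∈ T ×ˢ T
    · rw [if_pos h, Real.norm_eq_abs]
    · rw [if_neg h, norm_zero]; exact abs_nonneg _

/-- **`⟨∂₁(B·1_T), ∂₁(B·1_T)⟩ → ⟨∂₁B, ∂₁B⟩`** along the finite `T ⊂ ℤ^d`, for `B ∈ ℓ²(ℤ^d)` (dominated
convergence per direction, majorant `2(B(p)² + B(p + e_μ)²)`). [folklore] -/
theorem tendsto_energy_cutoff {B : X d → ℝ} (hB : Summable fun x => B x ^ 2) :
    Tendsto (fun T : Finset (X d) => energy (cutoff T B)) atTop (𝓝 (energy B)) := by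
  unfold energy
  refine tendsto_finsetSum _ fun μ _ => ?_
  refine tendsto_tsum_of_dominated_convergence (bound := fun p => 2 * (B p ^ 2 + B (p + e μ) ^ 2))
    ((hB.add (summable_sq_shift hB (e μ))).mul_left 2) (fun p => ?_) (Eventually.of_forall fun T p => ?_)
  · have hev : (fun T : Finset (X d) => (cutoff T B p - cutoff T B (p + e μ)) ^ 2)
        =ᶠ[atTop] fun _ => (B p - B (p + e μ)) ^ 2 := by
      filter_upwards [eventually_ge_atTop ({p, p + e μ} : Finset (X d))] with T hT
      rw [cutoff_of_mem (hT (by simp)), cutoff_of_mem (hT (by simp))]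
    exact tendsto_const_nhds.congr' hev.symm
  · rw [Real.norm_eq_abs, abs_of_nonneg (sq_nonneg _)]
    have h1 := sq_cutoff_le T B p
    have h2 := sq_cutoff_le T B (p + e μ)
    nlinarith [sq_nonneg (cutoff T B p + cutoff T B (p + e μ))]

/-! ## §5  (1.67) on `ℓ²(ℤ^d)` [print-located; proved outright] -/

/-- **(1.67), scalar, whole lattice, for EVERY square-summable coarse field** (no finite-support hypothesis):
`⟨∂₁B, ∂₁B⟩ ≤ ⟨B, Δ^{scalar}_{n,a}B⟩_{ℤ^d} ≤ (π²/4)^{d+1}·⟨∂₁B, ∂₁B⟩`, every `n`, every `a > 0`.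
[cite: Balaban1984PropagatorsI, (1.67) p.29] -/
theorem ineq167_scalar_l2 (n : ℕ) {a : ℝ} (ha : 0 < a) (B : X d → ℝ) (hB : Summable fun x => B x ^ 2) :
    energy B ≤ actionFormZd n a B ∧ actionFormZd n a B ≤ gamma1Sharp d * energy B := by
  have hT : ∀ T : Finset (X d),
      energy (cutoff T B) ≤ actionForm n a T B ∧ actionForm n a T B ≤ gamma1Sharp d * energy (cutoff T B) := by
    intro T
    have h := ineq167_scalar_sharp n ha T (cutoff T B) fun y hy => cutoff_of_not_mem hy
    rwa [actionForm_cutoff] at h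
  have hA := tendsto_actionForm n ha hB
  have hE := tendsto_energy_cutoff hB
  exact ⟨le_of_tendsto_of_tendsto' hE hA fun T => (hT T).1,
    le_of_tendsto_of_tendsto' hA (hE.const_mul (gamma1Sharp d)) fun T => (hT T).2⟩

/-- The lower half, `γ₀ = 1`: `⟨∂₁B, ∂₁B⟩ ≤ ⟨B, Δ^{scalar}_{n,a}B⟩_{ℤ^d}` on `ℓ²(ℤ^d)`.
[cite: Balaban1984PropagatorsI, (1.67) p.29] -/
theorem ineq167_lower_l2 (n : ℕ) {a : ℝ} (ha : 0 < a) (B : X d → ℝ) (hB : Summable fun x => B x ^ 2) :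
    energy B ≤ actionFormZd n a B :=
  (ineq167_scalar_l2 n ha B hB).1

/-- The upper half, `γ₁♯ = (π²/4)^{d+1}`: `⟨B, Δ^{scalar}_{n,a}B⟩_{ℤ^d} ≤ (π²/4)^{d+1}·⟨∂₁B, ∂₁B⟩` on `ℓ²(ℤ^d)`.
[cite: Balaban1984PropagatorsI, (1.67) p.29] -/
theorem ineq167_upper_l2 (n : ℕ) {a : ℝ} (ha : 0 < a) (B : X d → ℝ) (hB : Summable fun x => B x ^ 2) :
    actionFormZd n a B ≤ gamma1Sharp d * energy B :=
  (ineq167_scalar_l2 n ha B hB).2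

/-- Positivity of the whole-lattice form on `ℓ²(ℤ^d)`: `0 ≤ ⟨B, Δ^{scalar}_{n,a}B⟩_{ℤ^d}`. [folklore] -/
theorem actionFormZd_nonneg (n : ℕ) {a : ℝ} (ha : 0 < a) (B : X d → ℝ) (hB : Summable fun x => B x ^ 2) :
    0 ≤ actionFormZd n a B := by
  have hE : 0 ≤ energy B := Finset.sum_nonneg fun μ _ => tsum_nonneg fun p => sq_nonneg _
  exact hE.trans (ineq167_lower_l2 n ha B hB)

/-- **(1.67) in the printed shape, on `ℓ²(ℤ^d)`**: there are `γ₀, γ₁ > 0` depending on `d` only with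
`γ₀⟨∂₁B, ∂₁B⟩ ≤ ⟨B, Δ^{scalar}_{n,a}B⟩_{ℤ^d} ≤ γ₁⟨∂₁B, ∂₁B⟩` for every `n`, every `a > 0` and every square-summable
`B` (witnesses `γ₀ = 1`, `γ₁ = (π²/4)^{d+1}`). [cite: Balaban1984PropagatorsI, (1.67) p.29] -/
theorem ineq167_l2_exists (d : ℕ) :
    ∃ γ₀ γ₁ : ℝ, 0 < γ₀ ∧ 0 < γ₁ ∧ ∀ (n : ℕ) (a : ℝ), 0 < a → ∀ B : X d → ℝ, (Summable fun x => B x ^ 2) →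
      γ₀ * energy B ≤ actionFormZd n a B ∧ actionFormZd n a B ≤ γ₁ * energy B :=
  ⟨1, gamma1Sharp d, one_pos, gamma1Sharp_pos d, fun n _ ha B hB => by
    rw [one_mul]; exact ineq167_scalar_l2 n ha B hB⟩

/-! ## §6  The operator reading: `Δ^{scalar}_{n,a}B` row by row and `⟨B, Δ^{scalar}B⟩_{ℤ^d} = Σ_x B(x)(Δ^{scalar}B)(x)`
[folklore] -/

/-- The coarse action operator applied to a field: `(Δ^{scalar}_{n,a}B)(x) = Σ_y Δ^{scalar}(x,y)B(y)` (an
unconditional sum; convergent row by row on `ℓ²(ℤ^d)`, below). [cite: Balaban1984PropagatorsI, (1.65) p.29] -/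
def deltaApply (n : ℕ) (a : ℝ) (B : X d → ℝ) (x : X d) : ℝ := ∑' y : X d, actionKer n a x y * B y

/-- `|κ(z)| ≤ ‖κ‖_{ℓ¹}`. [folklore] -/
theorem abs_kappa_le_tsum (n : ℕ) {a : ℝ} (ha : 0 < a) (z : X d) :
    |kappa n a z| ≤ ∑' w : X d, |kappa n a w| :=
  (summable_abs_kappa n ha).le_tsum z fun _ _ => abs_nonneg _

/-- **Rows of `Δ^{scalar}` act on `ℓ²(ℤ^d)`**: `Σ_y Δ^{scalar}(x,y)B(y)` converges absolutely for square-summable `B`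
(majorant `(‖κ‖₁|κ(x − y)| + B(y)²)/2`). [folklore] -/
theorem summable_deltaApply_row (n : ℕ) {a : ℝ} (ha : 0 < a) {B : X d → ℝ} (hB : Summable fun x => B x ^ 2)
    (x : X d) : Summable fun y : X d => actionKer n a x y * B y := by
  have hκx : Summable fun y : X d => |kappa n a (x - y)| :=
    (Equiv.subLeft x).summable_iff.2 (summable_abs_kappa n ha)
  set K : ℝ := ∑' w : X d, |kappa n a w| with hK
  refine Summable.of_norm_bounded (((hκx.mul_left K).add hB).div_const 2) fun y => ?_
  rw [Real.norm_eq_abs, actionKer_eq_kappa n ha, abs_mul]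
  have h1 : |kappa n a (x - y)| ≤ K := abs_kappa_le_tsum n ha (x - y)
  have h2 : 0 ≤ |kappa n a (x - y)| := abs_nonneg _
  nlinarith [sq_nonneg (|kappa n a (x - y)| - |B y|), sq_abs (B y), abs_nonneg (B y)]

/-- **`⟨B, Δ^{scalar}_{n,a}B⟩_{ℤ^d} = Σ_x B(x)·(Δ^{scalar}_{n,a}B)(x)`** on `ℓ²(ℤ^d)`: the whole-lattice form is the
`ℓ²` pairing of `B` with `Δ^{scalar}B`. [cite: Balaban1984PropagatorsI, (1.65) p.29] -/
theorem actionFormZd_eq_inner (n : ℕ) {a : ℝ} (ha : 0 < a) {B : X d → ℝ} (hB : Summable fun x => B x ^ 2) :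
    actionFormZd n a B = ∑' x : X d, B x * deltaApply n a B x := by
  rw [actionFormZd_eq_tsum_tsum n ha hB]
  refine tsum_congr fun x => ?_
  rw [deltaApply, ← tsum_mul_left]
  exact tsum_congr fun y => by ring

end

end Literature.MathematicalPhysics.QuantumFieldTheory.Balaban1983to89.B5Ineq167L2Zd
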